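import Summits.QuantumFields.YangMills.Theorems.BalabanUVNodesN11DiagonalInductionCoPH

/-!
# DAG node N11 — THEOREM 1 OF [III] ALONG THE WHOLE LARGE-FIELD DIAGONAL AT THE v1.7 `CoPH` RECORD, WITH ITS LAW PACKAGE: for every level `k ≤ K` there are term values and
# a constant carrying BOTH conjuncts of `SLaw₁₃CoPH θ p k`'s per-sequence predicate at the all-large index `σ_k` — the inductive assumptions `Sect2.LawsRT … k` (2.27)–(2.31),
# (2.41)–(2.42) with analyticity, AND the post-𝐑 §2 dichotomy of `ρ_k`'s slot — because the diagonal is TERM-FREE (dag-n11-d): the ZERO witness serves, and the zero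
# witness obeys the inductive assumptions at every index along every ₁₃ history

Cell `pub-ymgap`, YM-PLAN Track A (HUMAN RULING D-0062), seat `pub-ymgap-dag-n11-e` (g12; R134 fan-out row N11∕s3 «`ThmP245Printed` via `rOperation` from N13's
`ROpLeaf` (pairs with n13-c)»), route `BalabanUVNodes` rev 25 (v1.7 `CoPH` key), item K1⁷ `StabilityBAtRecordR13SepCoPH` = stmt-QuantumFields-20542 (helper lane,
count-neutral).  [III] = [Balaban1988Convergent], [IV] = [Balaban1989LargeFieldI].  The law-level completion of this seat's clause-level induction
`…BalabanUVNodesN11DiagonalInductionCoPH` (p543058; its only import) — companion of `…BalabanUVNodesN11NoExpansionGeneralStepLawsCoPH` (the any-history step at law level, where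
the carried witness must be truncated; on the diagonal no truncation is needed: there are no terms at all).

WHY THIS FILE.  node00-def-T's `SLaw₁₃CoPH θ p k` is, per sequence `s`, «`Sect2.LawsRT (sect2TowerOfRecord … (θ.rzAt p s) s (t s)) lf k` ∧ (slot absent ∨ §2 identity a.e. on
`supp χ_k(s)`)» for a witness family `(t, E_k)` (FILE 27 §0a `HasSect2FormAtZS`).  The clause-level induction (p543058) delivers the SECOND conjunct at `σ_k` for every
`k ≤ K`; along the diagonal every `Λ_j = Ω_j = ∅`, so (2.23) reads NO term value (dag-n11-d's `…NoExpansionDiagonalCoPHSucc.clause_succ_CoPH_of_provisos_of_clause` concludes the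
𝐓-image clause for EVERY new witness `t′`; p543058 §2's `…succ_forall_terms…` face), and the ZERO term values `Sect2.TermValues.zero` obey the inductive assumptions at EVERY
index on EVERY tower of record whose flow satisfies the RG equations with nonnegative couplings and `0 ≤ E₀, B₀` (11c's `Sect2.lawsRT_towerOfTerms_zero`) — here: the run's
RG equation is a theorem (`settingOfRecord₁₃_satisfiesRG`), `g_{j+1} ≥ 0` is free (`gOfRecord₁₃_succ_nonneg`), `g₀ ≥ 0` is DISPLAYED on the run (`0 ≤ p.g0`), the two signs
displayed (at the witness of record `E₀ = B₀ = 1`).  HENCE: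
§1 `lawsRT_sect2TowerOfRecord_zero` — the zero witness obeys `Sect2.LawsRT … k` at every index `k` along every ₁₃ history, any residual (generic `θ : Stage13Params`).
§2 ★★ `diag_lawsRT_slotClause_all_CoPH_of_provisos_of_pins_of_liveSel` (generic `θ : Stage13HParams`; p543058 §1's hypotheses VERBATIM + `0 ≤ g₀`, `0 ≤ E₀, B₀`: for every
   `k ≤ K`, `∃ t E`, `LawsRT … k` at `σ_k` ∧ the post-𝐑 clause at `σ_k`; level `k+1` re-runs the step for the zero witness: the clause at `σ_k`, dag-n11-d's diagonal 𝐓-step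
   with `t′ := 0`, this seat's 𝐑-transfer `slotClauseΦ_succ_of_slotTClauseΦ_of_liveSel_of_rstep`, §1 at index `k+1`) · ★★★
   `diag_lawsRT_slotClause_all_doorCured_of_provisosCore_of_liveSel` (AT THE HISTORY-BLIND DOOR of node00-def-K0a's cured family from `θ₀.Provisos₁₃Core` + selector clause +
   `1 ≤ M` + `0 ≤ g₀, E₀, B₀` + displayed old-branch data ONLY — no pin, no prefix hypothesis) · ★★★ `diag_lawsRT_slotClause_all_doorCured_theta13LiveOfRecord_of_provisosCore` (AT THE
   DOOR OF THE CURED WITNESS OF RECORD: `Provisos₁₃Core` there + `0 ≤ g₀` + old-branch data ONLY; selector clause, `M = 1`, `E₀ = B₀ = 1` by the family).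

HONEST FRAMING.  Count-neutral kernel bookkeeping; the law conjunct costs nothing on the diagonal because there are no terms there — this is NOT evidence about the
expansion sequences (`Ω_j ≠ ∅`: [III] Sect. 1 ∕ §3 ∕ Thm 2 proper, where the terms live), NOT `SLaw₁₃CoPH θ p k` for `k ≥ 1` (all sequences + a universal-𝐄 witness
family), and the old-branch binders `hmB ∕ hCB` stay DISPLAYED exactly as in p543058 (restricted-averaging kernel: RN representative, no pointwise law in the tree); the
zero branch of the dichotomy is not excluded; nothing of Bałaban asserted; N11 NOT discharged; K1⁷ NOT closed; counts unmoved (typed 28∕28 · discharged 5∕27).  One finite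
`𝕋⁴_{L^K}` programme at fixed `ε = L^{−K}`; NOT ℝ⁴ ∕ OS ∕ mass-gap ∕ Clay.
Sources: [III] Thm 1 p.262, §2 p.262, Theorem p.245, (2.18) p.257, (2.23)–(2.31) pp.258–260, (2.41)–(2.42) p.261, (3.24)–(3.25) p.270, (1.11) p.248, (3.16)–(3.22) pp.268–269;
[IV] (0.3)–(0.4) p.176, p.177 (i)–(ii); [Balaban1987RG1] (0.17)–(0.20) pp.255–256.
-/

noncomputable section

open MeasureTheory
open scoped BigOperators Matrix.Norms.L2Operator

namespace Summit.QuantumFields.YangMills.Theorems.BalabanUVNodesN11DiagonalInductionLawsCoPH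

open Literature.MathematicalPhysics.QuantumFieldTheory.Balaban1983to89 T4Continuum Node00 Node00.Tk DagBinding
open Literature.MathematicalPhysics.QuantumFieldTheory.Balaban1983to89.B16RLeafRecord13LiveGenericZS
open Literature.MathematicalPhysics.QuantumFieldTheory.Balaban1983to89.B16RLeafRecord13AtLive (liveRepin₁₃_liveSel)
open BalabanUVNodesN11NoExpansionDiagonalCoPHSucc (clause_succ_CoPH_of_provisos_of_clause)
open BalabanUVNodesN11DiagonalPinAboveZero (init_seqAllLargeOfRecord)
open BalabanUVNodesN11DiagonalInductionCoPH (diag_slotClause_all_CoPH_of_provisos_of_pins_of_liveSel diag_slotClause_all_doorCured_of_provisosCore_of_liveSel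
  diag_slotClause_succ_forall_terms_doorCured_of_provisosCore_of_liveSel)

/-! ## §1. The zero witness obeys the inductive assumptions at every index along every ₁₃ history; §2. the diagonal induction with its law package -/

section DiagonalLaws

variable {F : T4Family} {N : ℕ} [NeZero N]

variable (F N) in
/-- **THE ZERO WITNESS OBEYS THE INDUCTIVE ASSUMPTIONS AT EVERY INDEX ALONG EVERY ₁₃ HISTORY** (11c's `Sect2.lawsRT_towerOfTerms_zero` at the setting of record: the run's RG
equation `settingOfRecord₁₃_satisfiesRG`, the displayed signs `0 ≤ E₀, B₀`, and `0 ≤ g_j` — `g₀ ≥ 0` displayed on the run, `g_{j+1} ≥ 0` free (`gOfRecord₁₃_succ_nonneg`)).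
[cite: Balaban1988Convergent, (2.27)–(2.31) pp.259–260, (2.42) p.261; Balaban1987RG1, (0.17)–(0.20) pp.255–256] -/
theorem lawsRT_sect2TowerOfRecord_zero (θ : Stage13Params F N) (p : B12.RunParams) (hg0 : 0 ≤ p.g0) (hE₀ : 0 ≤ θ.s2.lf.E₀) (hB₀ : 0 ≤ θ.s2.lf.B₀)
    (Rz : Sect2.Residual (F.P p.K) (MatA N)) {n : ℕ} (s : SeqOfRecord F θ.ν θ.τ9.M (gOfRecord₁₃ F N θ p) p.K n) (k : ℕ) :
    Sect2.LawsRT (sect2TowerOfRecord F N (FluctV N) p.K (settingOfRecord₁₃ F N θ p) Rz s Sect2.TermValues.zero) (settingOfRecord₁₃ F N θ p).lf k := by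
  refine Sect2.lawsRT_towerOfTerms_zero _ _ _ _ k (settingOfRecord₁₃_satisfiesRG F N θ p k) hE₀ hB₀ fun j _ => ?_
  rcases j with _ | j
  · show 0 ≤ FlowStepRuns.genSeq _ _ 0
    rw [FlowStepRuns.genSeq_zero]
    exact hg0
  · exact B16RLeafRecord13Live.gOfRecord₁₃_succ_nonneg F N θ p j

variable (θ : Stage13HParams F N) (p : B12.RunParams) in
/-- **★★ THEOREM 1 ALONG THE LARGE-FIELD DIAGONAL WITH ITS LAW PACKAGE, generic `θ : Stage13HParams`** — for every `k ≤ K` THERE ARE term values and a constant carrying BOTH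
conjuncts of `SLaw₁₃CoPH θ p k`'s predicate at the all-large index `σ_k`: the inductive assumptions `Sect2.LawsRT (sect2TowerOfRecord … (θ.rzAt p σ_k) σ_k t) lf k` AND the post-𝐑
§2 dichotomy of `ρ_k`'s slot at `σ_k`.  Hypotheses: this seat's `…N11DiagonalInductionCoPH` §1's VERBATIM (core provisos, selector clause, `1 ≤ M`, displayed pins ∕ prefix
agreements ∕ old-branch data) + the run's `0 ≤ g₀` and the signs `0 ≤ E₀, B₀`.  Level 0: the clause-level theorem + `LawsRT.zero`; level `k+1`: the clause at `σ_k`, dag-n11-d's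
diagonal 𝐓-step `clause_succ_CoPH_of_provisos_of_clause` for the ZERO new witness (its conclusion holds for EVERY `t′` — the diagonal is term-free), this seat's 𝐑-transfer,
and `lawsRT_sect2TowerOfRecord_zero` at index `k+1`. [cite: Balaban1988Convergent, Thm 1 p.262, §2 p.262, Theorem p.245, (3.24)–(3.25) p.270, (2.18) p.257, (2.27)–(2.31) pp.259–260; Balaban1989LargeFieldI, (0.3) p.176, p.177 (i)–(ii); Balaban1987RG1, (0.20) p.256] -/
theorem diag_lawsRT_slotClause_all_CoPH_of_provisos_of_pins_of_liveSel (h : θ.Provisos₁₃CoPH F N)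
    (hg0 : 0 ≤ p.g0) (hE₀ : 0 ≤ θ.s2.lf.E₀) (hB₀ : 0 ≤ θ.s2.lf.B₀)
    (hsel : θ.ppSel = ppSelLiveOfRecord F N θ.ν θ.τ9 (EOfRecord₁₃ F N θ.toStage13Params) (wOfRecord₉ F N θ.toStage9Params)) (hM : 1 ≤ θ.τ9.M)
    (hq : ∀ k, k < p.K → ∀ (j : ℕ) (ω : MultiCfg (F.P p.K) (SU N) (FluctV N)),
      (θ.zhAt p (seqAllLargeOfRecord F θ.ν θ.τ9.M (gOfRecord₁₃ F N θ.toStage13Params p) p.K (k + 1))).quad j ∅ ω = 0)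
    (hpre : ∀ k, k < p.K → ∀ j, j < k →
      (θ.zhAt p (seqAllLargeOfRecord F θ.ν θ.τ9.M (gOfRecord₁₃ F N θ.toStage13Params p) p.K (k + 1))).ζ0 j =
          (θ.zhAt p (seqAllLargeOfRecord F θ.ν θ.τ9.M (gOfRecord₁₃ F N θ.toStage13Params p) p.K k)).ζ0 j ∧
        (θ.zhAt p (seqAllLargeOfRecord F θ.ν θ.τ9.M (gOfRecord₁₃ F N θ.toStage13Params p) p.K (k + 1))).quad j =
          (θ.zhAt p (seqAllLargeOfRecord F θ.ν θ.τ9.M (gOfRecord₁₃ F N θ.toStage13Params p) p.K k)).quad j)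
    (hZ : ∀ k, k < p.K → ∀ (V' : GaugeField (F.P p.K) (k + 1) (SU N)) (U₀ : GaugeField (F.P p.K) k (SU N)),
      (θ.zhAt p (seqAllLargeOfRecord F θ.ν θ.τ9.M (gOfRecord₁₃ F N θ.toStage13Params p) p.K (k + 1))).ζ0 k Set.univ (pairCfgAt (V := FluctV N) k V' U₀) =
        wOfRecord₉ F N θ.toStage9Params p (gOfRecord₁₃ F N θ.toStage13Params p) k
          (seqAllLargeOfRecord F θ.ν θ.τ9.M (gOfRecord₁₃ F N θ.toStage13Params p) p.K (k + 1)) U₀ ((avOfRecord F N p.K k).avg U₀))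
    (C : ℕ → ℝ)
    (hmB : ∀ k, k < p.K → ∀ (t : Sect2.TermValues (F.P p.K) (MatA N) (FluctV N) θ.τ9.M) (E : ℝ),
      Measurable fun U₀ : GaugeField (F.P p.K) k (SU N) =>
        tkBranchOfRecord F N (FluctV N) θ.ν θ.τ9.M _ p.K
          (WtOfRecord₁₃H F N θ p (seqAllLargeOfRecord F θ.ν θ.τ9.M (gOfRecord₁₃ F N θ.toStage13Params p) p.K (k + 1)))
          (seqAllLargeOfRecord F θ.ν θ.τ9.M (gOfRecord₁₃ F N θ.toStage13Params p) p.K k) (fun _ => ∅) k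
          (fun ω => sect2Operand F N (FluctV N) p.K (settingOfRecord₁₃ F N θ.toStage13Params p)
            (θ.rzAt p (seqAllLargeOfRecord F θ.ν θ.τ9.M (gOfRecord₁₃ F N θ.toStage13Params p) p.K k))
            (seqAllLargeOfRecord F θ.ν θ.τ9.M (gOfRecord₁₃ F N θ.toStage13Params p) p.K k) t E
            (UbgOfRecord₁₃CoP F N θ.toStage13Params p k (seqAllLargeOfRecord F θ.ν θ.τ9.M (gOfRecord₁₃ F N θ.toStage13Params p) p.K k))
            ((fun _ => ∅ : ℕ → Set (Site (F.P p.K) 0)), fun j => (ω j).2) (fun j => (ω j).1))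
          (baseCfg (V := FluctV N) k U₀))
    (hCB : ∀ k, k < p.K → ∀ (t : Sect2.TermValues (F.P p.K) (MatA N) (FluctV N) θ.τ9.M) (E : ℝ) (U₀ : GaugeField (F.P p.K) k (SU N)),
      |tkBranchOfRecord F N (FluctV N) θ.ν θ.τ9.M _ p.K
          (WtOfRecord₁₃H F N θ p (seqAllLargeOfRecord F θ.ν θ.τ9.M (gOfRecord₁₃ F N θ.toStage13Params p) p.K (k + 1)))
          (seqAllLargeOfRecord F θ.ν θ.τ9.M (gOfRecord₁₃ F N θ.toStage13Params p) p.K k) (fun _ => ∅) k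
          (fun ω => sect2Operand F N (FluctV N) p.K (settingOfRecord₁₃ F N θ.toStage13Params p)
            (θ.rzAt p (seqAllLargeOfRecord F θ.ν θ.τ9.M (gOfRecord₁₃ F N θ.toStage13Params p) p.K k))
            (seqAllLargeOfRecord F θ.ν θ.τ9.M (gOfRecord₁₃ F N θ.toStage13Params p) p.K k) t E
            (UbgOfRecord₁₃CoP F N θ.toStage13Params p k (seqAllLargeOfRecord F θ.ν θ.τ9.M (gOfRecord₁₃ F N θ.toStage13Params p) p.K k))
            ((fun _ => ∅ : ℕ → Set (Site (F.P p.K) 0)), fun j => (ω j).2) (fun j => (ω j).1))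
          (baseCfg (V := FluctV N) k U₀)| ≤ C k) :
    ∀ k, k ≤ p.K → ∃ (t : Sect2.TermValues (F.P p.K) (MatA N) (FluctV N) θ.τ9.M) (E : ℝ),
      Sect2.LawsRT (sect2TowerOfRecord F N (FluctV N) p.K (settingOfRecord₁₃ F N θ.toStage13Params p)
        (θ.rzAt p (seqAllLargeOfRecord F θ.ν θ.τ9.M (gOfRecord₁₃ F N θ.toStage13Params p) p.K k))
        (seqAllLargeOfRecord F θ.ν θ.τ9.M (gOfRecord₁₃ F N θ.toStage13Params p) p.K k) t) (settingOfRecord₁₃ F N θ.toStage13Params p).lf k ∧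
     (      slotsOfRecord F N θ.ν θ.τ9 (EOfRecord₁₃ F N θ.toStage13Params) (wOfRecord₉ F N θ.toStage9Params) θ.ppSel p (gOfRecord₁₃ F N θ.toStage13Params p) k
          (seqAllLargeOfRecord F θ.ν θ.τ9.M (gOfRecord₁₃ F N θ.toStage13Params p) p.K k) = 0 ∨
        ∀ᵐ U ∂fieldMeasure (F.P p.K) k (SU N),
          chiSeqOfRecord F N θ.ν θ.τ9.M (gOfRecord₁₃ F N θ.toStage13Params p) p.K k (seqAllLargeOfRecord F θ.ν θ.τ9.M (gOfRecord₁₃ F N θ.toStage13Params p) p.K k) U ≠ 0 →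
            slotsOfRecord F N θ.ν θ.τ9 (EOfRecord₁₃ F N θ.toStage13Params) (wOfRecord₉ F N θ.toStage9Params) θ.ppSel p (gOfRecord₁₃ F N θ.toStage13Params p) k
                (seqAllLargeOfRecord F θ.ν θ.τ9.M (gOfRecord₁₃ F N θ.toStage13Params p) p.K k) U =
              sect2Slot F N (FluctV N) p.K (settingOfRecord₁₃ F N θ.toStage13Params p)
                (θ.rzAt p (seqAllLargeOfRecord F θ.ν θ.τ9.M (gOfRecord₁₃ F N θ.toStage13Params p) p.K k))
                (WtOfRecord₁₃H F N θ p (seqAllLargeOfRecord F θ.ν θ.τ9.M (gOfRecord₁₃ F N θ.toStage13Params p) p.K k))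
                (seqAllLargeOfRecord F θ.ν θ.τ9.M (gOfRecord₁₃ F N θ.toStage13Params p) p.K k) t E
                (UbgOfRecord₁₃CoP F N θ.toStage13Params p k (seqAllLargeOfRecord F θ.ν θ.τ9.M (gOfRecord₁₃ F N θ.toStage13Params p) p.K k)) U) := by
  intro k hk
  rcases k with _ | k
  · -- level 0: the start of Theorem 1; the inductive assumptions at index 0 are vacuous
    obtain ⟨t, E, hcl⟩ := diag_slotClause_all_CoPH_of_provisos_of_pins_of_liveSel θ p h hsel hM hq hpre hZ C hmB hCB 0 hk
    exact ⟨t, E, Sect2.LawsRT.zero _ _, hcl⟩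
  · -- level k+1: the clause at σ_k (clause-level induction), dag-n11-d's diagonal 𝐓-step for the ZERO new witness (the diagonal is term-free), this seat's 𝐑-transfer,
    -- and the inductive assumptions of the zero witness at index k+1
    have hk' : k < p.K := Nat.lt_of_succ_le hk
    obtain ⟨t₀, E₀, hid⟩ := diag_slotClause_all_CoPH_of_provisos_of_pins_of_liveSel θ p h hsel hM hq hpre hZ C hmB hCB k hk'.le
    have hinit := init_seqAllLargeOfRecord (F := F) θ.ν θ.τ9.M p (gOfRecord₁₃ F N θ.toStage13Params p) k
    have hT := clause_succ_CoPH_of_provisos_of_clause θ p h hk' hM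
      (seqAllLargeOfRecord F θ.ν θ.τ9.M (gOfRecord₁₃ F N θ.toStage13Params p) p.K (k + 1)) (fun j _ _ => rfl) (hq k hk')
      (by rw [hinit]; exact hpre k hk') t₀ E₀ (by rw [hinit]; exact hid) (hZ k hk')
      (C := C k) (by rw [hinit]; exact hmB k hk' t₀ E₀) (by rw [hinit]; exact hCB k hk' t₀ E₀) Sect2.TermValues.zero
    exact ⟨Sect2.TermValues.zero, E₀, lawsRT_sect2TowerOfRecord_zero F N θ.toStage13Params p hg0 hE₀ hB₀ _ _ (k + 1),
      slotClauseΦ_succ_of_slotTClauseΦ_of_liveSel_of_rstep F N θ.toStage13Params p (fun q j _ hj => h.rstep q j hj) hsel k hk' _ _ fun _ => hT⟩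

variable (θ₀ : Stage13Params F N) (p : B12.RunParams) in
/-- **★★★ … AT THE HISTORY-BLIND DOOR OF node00-def-K0a's CURED FAMILY** `Stage13HParams.ofHistoryBlind (Stage13RParams.ofCured θ₀)` from `θ₀.Provisos₁₃Core`, the selector clause,
`1 ≤ M`, `0 ≤ g₀`, `0 ≤ E₀, B₀` and the displayed old-branch data ONLY (no pin, no prefix hypothesis): for every `k ≤ K`, BOTH conjuncts of the §2 form of `ρ_k` at `σ_k`
(this seat's `…N11DiagonalInductionCoPH` §2; above level 0 its `…succ_forall_terms…` face serves the ZERO witness). [cite: Balaban1988Convergent, Thm 1 p.262, §2 p.262, Theorem p.245, (3.24)–(3.25) p.270, (2.27)–(2.31) pp.259–260; Balaban1989LargeFieldI, (0.3) p.176, p.177 (i)–(ii); Balaban1987RG1, (0.20) p.256] -/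
theorem diag_lawsRT_slotClause_all_doorCured_of_provisosCore_of_liveSel (h : θ₀.Provisos₁₃Core F N)
    (hg0 : 0 ≤ p.g0) (hE₀ : 0 ≤ θ₀.s2.lf.E₀) (hB₀ : 0 ≤ θ₀.s2.lf.B₀)
    (hsel : θ₀.ppSel = ppSelLiveOfRecord F N θ₀.ν θ₀.τ9 (EOfRecord₁₃ F N θ₀) (wOfRecord₉ F N θ₀.toStage9Params)) (hM : 1 ≤ θ₀.τ9.M) (C : ℕ → ℝ)
    (hmB : ∀ k, k < p.K → ∀ (t : Sect2.TermValues (F.P p.K) (MatA N) (FluctV N) θ₀.τ9.M) (E : ℝ),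
      Measurable fun U₀ : GaugeField (F.P p.K) k (SU N) =>
        tkBranchOfRecord F N (FluctV N) θ₀.ν θ₀.τ9.M _ p.K
          (WtOfRecord₁₃H F N (Stage13HParams.ofHistoryBlind F N (Stage13RParams.ofCured F N θ₀)) p
            (seqAllLargeOfRecord F θ₀.ν θ₀.τ9.M (gOfRecord₁₃ F N θ₀ p) p.K k))
          (seqAllLargeOfRecord F θ₀.ν θ₀.τ9.M (gOfRecord₁₃ F N θ₀ p) p.K k) (fun _ => ∅) k
          (fun ω => sect2Operand F N (FluctV N) p.K (settingOfRecord₁₃ F N θ₀ p)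
            ((Stage13HParams.ofHistoryBlind F N (Stage13RParams.ofCured F N θ₀)).rzAt p (seqAllLargeOfRecord F θ₀.ν θ₀.τ9.M (gOfRecord₁₃ F N θ₀ p) p.K k))
            (seqAllLargeOfRecord F θ₀.ν θ₀.τ9.M (gOfRecord₁₃ F N θ₀ p) p.K k) t E
            (UbgOfRecord₁₃CoP F N θ₀ p k (seqAllLargeOfRecord F θ₀.ν θ₀.τ9.M (gOfRecord₁₃ F N θ₀ p) p.K k))
            ((fun _ => ∅ : ℕ → Set (Site (F.P p.K) 0)), fun j => (ω j).2) (fun j => (ω j).1))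
          (baseCfg (V := FluctV N) k U₀))
    (hCB : ∀ k, k < p.K → ∀ (t : Sect2.TermValues (F.P p.K) (MatA N) (FluctV N) θ₀.τ9.M) (E : ℝ) (U₀ : GaugeField (F.P p.K) k (SU N)),
      |tkBranchOfRecord F N (FluctV N) θ₀.ν θ₀.τ9.M _ p.K
          (WtOfRecord₁₃H F N (Stage13HParams.ofHistoryBlind F N (Stage13RParams.ofCured F N θ₀)) p
            (seqAllLargeOfRecord F θ₀.ν θ₀.τ9.M (gOfRecord₁₃ F N θ₀ p) p.K k))
          (seqAllLargeOfRecord F θ₀.ν θ₀.τ9.M (gOfRecord₁₃ F N θ₀ p) p.K k) (fun _ => ∅) k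
          (fun ω => sect2Operand F N (FluctV N) p.K (settingOfRecord₁₃ F N θ₀ p)
            ((Stage13HParams.ofHistoryBlind F N (Stage13RParams.ofCured F N θ₀)).rzAt p (seqAllLargeOfRecord F θ₀.ν θ₀.τ9.M (gOfRecord₁₃ F N θ₀ p) p.K k))
            (seqAllLargeOfRecord F θ₀.ν θ₀.τ9.M (gOfRecord₁₃ F N θ₀ p) p.K k) t E
            (UbgOfRecord₁₃CoP F N θ₀ p k (seqAllLargeOfRecord F θ₀.ν θ₀.τ9.M (gOfRecord₁₃ F N θ₀ p) p.K k))
            ((fun _ => ∅ : ℕ → Set (Site (F.P p.K) 0)), fun j => (ω j).2) (fun j => (ω j).1))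
          (baseCfg (V := FluctV N) k U₀)| ≤ C k) :
    ∀ k, k ≤ p.K → ∃ (t : Sect2.TermValues (F.P p.K) (MatA N) (FluctV N) θ₀.τ9.M) (E : ℝ),
      Sect2.LawsRT (sect2TowerOfRecord F N (FluctV N) p.K (settingOfRecord₁₃ F N θ₀ p)
        ((Stage13HParams.ofHistoryBlind F N (Stage13RParams.ofCured F N θ₀)).rzAt p (seqAllLargeOfRecord F θ₀.ν θ₀.τ9.M (gOfRecord₁₃ F N θ₀ p) p.K k))
        (seqAllLargeOfRecord F θ₀.ν θ₀.τ9.M (gOfRecord₁₃ F N θ₀ p) p.K k) t) (settingOfRecord₁₃ F N θ₀ p).lf k ∧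
     (      slotsOfRecord F N θ₀.ν θ₀.τ9 (EOfRecord₁₃ F N θ₀) (wOfRecord₉ F N θ₀.toStage9Params) θ₀.ppSel p (gOfRecord₁₃ F N θ₀ p) k
          (seqAllLargeOfRecord F θ₀.ν θ₀.τ9.M (gOfRecord₁₃ F N θ₀ p) p.K k) = 0 ∨
        ∀ᵐ U ∂fieldMeasure (F.P p.K) k (SU N),
          chiSeqOfRecord F N θ₀.ν θ₀.τ9.M (gOfRecord₁₃ F N θ₀ p) p.K k (seqAllLargeOfRecord F θ₀.ν θ₀.τ9.M (gOfRecord₁₃ F N θ₀ p) p.K k) U ≠ 0 →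
            slotsOfRecord F N θ₀.ν θ₀.τ9 (EOfRecord₁₃ F N θ₀) (wOfRecord₉ F N θ₀.toStage9Params) θ₀.ppSel p (gOfRecord₁₃ F N θ₀ p) k
                (seqAllLargeOfRecord F θ₀.ν θ₀.τ9.M (gOfRecord₁₃ F N θ₀ p) p.K k) U =
              sect2Slot F N (FluctV N) p.K (settingOfRecord₁₃ F N θ₀ p)
                ((Stage13HParams.ofHistoryBlind F N (Stage13RParams.ofCured F N θ₀)).rzAt p (seqAllLargeOfRecord F θ₀.ν θ₀.τ9.M (gOfRecord₁₃ F N θ₀ p) p.K k))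
                (WtOfRecord₁₃H F N (Stage13HParams.ofHistoryBlind F N (Stage13RParams.ofCured F N θ₀)) p
                  (seqAllLargeOfRecord F θ₀.ν θ₀.τ9.M (gOfRecord₁₃ F N θ₀ p) p.K k))
                (seqAllLargeOfRecord F θ₀.ν θ₀.τ9.M (gOfRecord₁₃ F N θ₀ p) p.K k) t E
                (UbgOfRecord₁₃CoP F N θ₀ p k (seqAllLargeOfRecord F θ₀.ν θ₀.τ9.M (gOfRecord₁₃ F N θ₀ p) p.K k)) U) := by
  intro k hk
  rcases k with _ | k
  · obtain ⟨t, E, hcl⟩ := diag_slotClause_all_doorCured_of_provisosCore_of_liveSel θ₀ p h hsel hM C hmB hCB 0 hk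
    exact ⟨t, E, Sect2.LawsRT.zero _ _, hcl⟩
  · -- above level 0 the clause holds for EVERY witness (the diagonal is term-free): take the ZERO witness, whose inductive assumptions hold at every index
    obtain ⟨E, hcl⟩ := diag_slotClause_succ_forall_terms_doorCured_of_provisosCore_of_liveSel θ₀ p h hsel hM C hmB hCB k (Nat.lt_of_succ_le hk)
      Sect2.TermValues.zero
    exact ⟨Sect2.TermValues.zero, E, lawsRT_sect2TowerOfRecord_zero F N θ₀ p hg0 hE₀ hB₀ _ _ (k + 1), hcl⟩

variable (F N) (p : B12.RunParams) in
/-- **★★★ … AT THE DOOR OF THE CURED WITNESS OF RECORD** `Stage13HParams.ofHistoryBlind (Stage13RParams.ofCured (theta13LiveOfRecord F N))` from `Provisos₁₃Core` AT THE WITNESS,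
the run's `0 ≤ g₀` and the displayed old-branch data ONLY (selector clause `liveRepin₁₃_liveSel`, `M = 1`, `E₀ = B₀ = 1` by the family's numerals): for every `k ≤ K`, BOTH
conjuncts of the §2 form of `ρ_k` — the inductive assumptions (2.27)–(2.31), (2.41)–(2.42) with analyticity AND the post-𝐑 §2 dichotomy — at the all-large index of length `k`.
[cite: Balaban1988Convergent, Thm 1 p.262, §2 p.262, Theorem p.245, (3.24)–(3.25) p.270, (1.11) p.248, (3.16)–(3.22) pp.268–269; Balaban1989LargeFieldI, (0.3)–(0.4) p.176, p.177 (i)–(ii); Balaban1987RG1, (0.20) p.256] -/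
theorem diag_lawsRT_slotClause_all_doorCured_theta13LiveOfRecord_of_provisosCore (h : (theta13LiveOfRecord F N).Provisos₁₃Core F N) (hg0 : 0 ≤ p.g0)
    (C : ℕ → ℝ)
    (hmB : ∀ k, k < p.K → ∀ (t : Sect2.TermValues (F.P p.K) (MatA N) (FluctV N) (theta13LiveOfRecord F N).τ9.M) (E : ℝ),
      Measurable fun U₀ : GaugeField (F.P p.K) k (SU N) =>
        tkBranchOfRecord F N (FluctV N) (theta13LiveOfRecord F N).ν (theta13LiveOfRecord F N).τ9.M _ p.K
          (WtOfRecord₁₃H F N (Stage13HParams.ofHistoryBlind F N (Stage13RParams.ofCured F N (theta13LiveOfRecord F N))) p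
            (seqAllLargeOfRecord F (theta13LiveOfRecord F N).ν (theta13LiveOfRecord F N).τ9.M (gOfRecord₁₃ F N (theta13LiveOfRecord F N) p) p.K k))
          (seqAllLargeOfRecord F (theta13LiveOfRecord F N).ν (theta13LiveOfRecord F N).τ9.M (gOfRecord₁₃ F N (theta13LiveOfRecord F N) p) p.K k) (fun _ => ∅) k
          (fun ω => sect2Operand F N (FluctV N) p.K (settingOfRecord₁₃ F N (theta13LiveOfRecord F N) p)
            ((Stage13HParams.ofHistoryBlind F N (Stage13RParams.ofCured F N (theta13LiveOfRecord F N))).rzAt p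
              (seqAllLargeOfRecord F (theta13LiveOfRecord F N).ν (theta13LiveOfRecord F N).τ9.M (gOfRecord₁₃ F N (theta13LiveOfRecord F N) p) p.K k))
            (seqAllLargeOfRecord F (theta13LiveOfRecord F N).ν (theta13LiveOfRecord F N).τ9.M (gOfRecord₁₃ F N (theta13LiveOfRecord F N) p) p.K k) t E
            (UbgOfRecord₁₃CoP F N (theta13LiveOfRecord F N) p k
              (seqAllLargeOfRecord F (theta13LiveOfRecord F N).ν (theta13LiveOfRecord F N).τ9.M (gOfRecord₁₃ F N (theta13LiveOfRecord F N) p) p.K k))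
            ((fun _ => ∅ : ℕ → Set (Site (F.P p.K) 0)), fun j => (ω j).2) (fun j => (ω j).1))
          (baseCfg (V := FluctV N) k U₀))
    (hCB : ∀ k, k < p.K → ∀ (t : Sect2.TermValues (F.P p.K) (MatA N) (FluctV N) (theta13LiveOfRecord F N).τ9.M) (E : ℝ) (U₀ : GaugeField (F.P p.K) k (SU N)),
      |tkBranchOfRecord F N (FluctV N) (theta13LiveOfRecord F N).ν (theta13LiveOfRecord F N).τ9.M _ p.K
          (WtOfRecord₁₃H F N (Stage13HParams.ofHistoryBlind F N (Stage13RParams.ofCured F N (theta13LiveOfRecord F N))) p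
            (seqAllLargeOfRecord F (theta13LiveOfRecord F N).ν (theta13LiveOfRecord F N).τ9.M (gOfRecord₁₃ F N (theta13LiveOfRecord F N) p) p.K k))
          (seqAllLargeOfRecord F (theta13LiveOfRecord F N).ν (theta13LiveOfRecord F N).τ9.M (gOfRecord₁₃ F N (theta13LiveOfRecord F N) p) p.K k) (fun _ => ∅) k
          (fun ω => sect2Operand F N (FluctV N) p.K (settingOfRecord₁₃ F N (theta13LiveOfRecord F N) p)
            ((Stage13HParams.ofHistoryBlind F N (Stage13RParams.ofCured F N (theta13LiveOfRecord F N))).rzAt p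
              (seqAllLargeOfRecord F (theta13LiveOfRecord F N).ν (theta13LiveOfRecord F N).τ9.M (gOfRecord₁₃ F N (theta13LiveOfRecord F N) p) p.K k))
            (seqAllLargeOfRecord F (theta13LiveOfRecord F N).ν (theta13LiveOfRecord F N).τ9.M (gOfRecord₁₃ F N (theta13LiveOfRecord F N) p) p.K k) t E
            (UbgOfRecord₁₃CoP F N (theta13LiveOfRecord F N) p k
              (seqAllLargeOfRecord F (theta13LiveOfRecord F N).ν (theta13LiveOfRecord F N).τ9.M (gOfRecord₁₃ F N (theta13LiveOfRecord F N) p) p.K k))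
            ((fun _ => ∅ : ℕ → Set (Site (F.P p.K) 0)), fun j => (ω j).2) (fun j => (ω j).1))
          (baseCfg (V := FluctV N) k U₀)| ≤ C k) :
    ∀ k, k ≤ p.K → ∃ (t : Sect2.TermValues (F.P p.K) (MatA N) (FluctV N) (theta13LiveOfRecord F N).τ9.M) (E : ℝ),
      Sect2.LawsRT (sect2TowerOfRecord F N (FluctV N) p.K (settingOfRecord₁₃ F N (theta13LiveOfRecord F N) p)
        ((Stage13HParams.ofHistoryBlind F N (Stage13RParams.ofCured F N (theta13LiveOfRecord F N))).rzAt p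
          (seqAllLargeOfRecord F (theta13LiveOfRecord F N).ν (theta13LiveOfRecord F N).τ9.M (gOfRecord₁₃ F N (theta13LiveOfRecord F N) p) p.K k))
        (seqAllLargeOfRecord F (theta13LiveOfRecord F N).ν (theta13LiveOfRecord F N).τ9.M (gOfRecord₁₃ F N (theta13LiveOfRecord F N) p) p.K k) t)
        (settingOfRecord₁₃ F N (theta13LiveOfRecord F N) p).lf k ∧
     (      slotsOfRecord F N (theta13LiveOfRecord F N).ν (theta13LiveOfRecord F N).τ9 (EOfRecord₁₃ F N (theta13LiveOfRecord F N))
          (wOfRecord₉ F N (theta13LiveOfRecord F N).toStage9Params) (theta13LiveOfRecord F N).ppSel p (gOfRecord₁₃ F N (theta13LiveOfRecord F N) p) k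
          (seqAllLargeOfRecord F (theta13LiveOfRecord F N).ν (theta13LiveOfRecord F N).τ9.M (gOfRecord₁₃ F N (theta13LiveOfRecord F N) p) p.K k) = 0 ∨
        ∀ᵐ U ∂fieldMeasure (F.P p.K) k (SU N),
          chiSeqOfRecord F N (theta13LiveOfRecord F N).ν (theta13LiveOfRecord F N).τ9.M (gOfRecord₁₃ F N (theta13LiveOfRecord F N) p) p.K k
              (seqAllLargeOfRecord F (theta13LiveOfRecord F N).ν (theta13LiveOfRecord F N).τ9.M (gOfRecord₁₃ F N (theta13LiveOfRecord F N) p) p.K k) U ≠ 0 →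
            slotsOfRecord F N (theta13LiveOfRecord F N).ν (theta13LiveOfRecord F N).τ9 (EOfRecord₁₃ F N (theta13LiveOfRecord F N))
                (wOfRecord₉ F N (theta13LiveOfRecord F N).toStage9Params) (theta13LiveOfRecord F N).ppSel p (gOfRecord₁₃ F N (theta13LiveOfRecord F N) p) k
                (seqAllLargeOfRecord F (theta13LiveOfRecord F N).ν (theta13LiveOfRecord F N).τ9.M (gOfRecord₁₃ F N (theta13LiveOfRecord F N) p) p.K k) U =
              sect2Slot F N (FluctV N) p.K (settingOfRecord₁₃ F N (theta13LiveOfRecord F N) p)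
                ((Stage13HParams.ofHistoryBlind F N (Stage13RParams.ofCured F N (theta13LiveOfRecord F N))).rzAt p
                  (seqAllLargeOfRecord F (theta13LiveOfRecord F N).ν (theta13LiveOfRecord F N).τ9.M (gOfRecord₁₃ F N (theta13LiveOfRecord F N) p) p.K k))
                (WtOfRecord₁₃H F N (Stage13HParams.ofHistoryBlind F N (Stage13RParams.ofCured F N (theta13LiveOfRecord F N))) p
                  (seqAllLargeOfRecord F (theta13LiveOfRecord F N).ν (theta13LiveOfRecord F N).τ9.M (gOfRecord₁₃ F N (theta13LiveOfRecord F N) p) p.K k))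
                (seqAllLargeOfRecord F (theta13LiveOfRecord F N).ν (theta13LiveOfRecord F N).τ9.M (gOfRecord₁₃ F N (theta13LiveOfRecord F N) p) p.K k) t E
                (UbgOfRecord₁₃CoP F N (theta13LiveOfRecord F N) p k
                  (seqAllLargeOfRecord F (theta13LiveOfRecord F N).ν (theta13LiveOfRecord F N).τ9.M (gOfRecord₁₃ F N (theta13LiveOfRecord F N) p) p.K k)) U) :=
  diag_lawsRT_slotClause_all_doorCured_of_provisosCore_of_liveSel (theta13LiveOfRecord F N) p h hg0 zero_le_one zero_le_one
    (liveRepin₁₃_liveSel F N (theta13OfFamily F N eps0OfRecord₁₃ _ _ _)) (le_of_eq rfl) C hmB hCB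

end DiagonalLaws

end Summit.QuantumFields.YangMills.Theorems.BalabanUVNodesN11DiagonalInductionLawsCoPH

end
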